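import Mathlib
import Summits.ValiantsHypothesis.ValiantsHypothesis.Theorems.LacunarySymmetroidMatrixDescartesCensusSharpRows
import Summits.ValiantsHypothesis.ValiantsHypothesis.Theorems.LacunarySymmetroidMatrixDescartesCensusWindowFourWitnessMult

/-!
# `MatrixDescartes` census — the WINDOW-4 ROW of a sharp fewnomial (multiplicity form; the hull-edge LP's «W4 split»)

HONEST FRAMING.  Object-search cell `pub-symmetroid`, door-A target `DoorA26 := PosRootLawAt 2 6 19`
(stmt-ValiantsHypothesis-19979; OPEN, typed, never asserted).  Companion of `…CensusSharpRows` (the circuit row of every TRIPLE of a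
sharp fewnomial, engine-2 g28) and `…CensusWindowFourWitnessMult` (the left witness rows with multiplicity, engine-2 g30).

Let `Σ_{t<n} c_t X^{e_t}` (exponents strictly increasing on `range n`) have at least `n − 1` positive roots counted with multiplicity
(a Descartes-sharp hull-edge form) and let `r < s < u < v < n`, gaps `U₁ = e_s − e_r`, `V = e_u − e_s`, `W = e_v − e_u`, `S = U₁+V+W`.
Killing the other `n − 4` exponents by Euler twists (`countP_posRoots_le_countP_twists`) leaves the alternating 4-nomial
`c_r P_r X^{e_r} + c_s P_s X^{e_s} + c_u P_u X^{e_u} + c_v P_v X^{e_v}`, `P_t = ∏_{w<n, w∉{r,s,u,v}} (e_t − e_w)`, with at least THREE positive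
roots counted with multiplicity (`window_four_countP_of_sharp`).  With `A, B, Cc, E = |c_t|·M_t` (`M_t = |P_t|`) the left parametric
witness row with multiplicity (`fourNomial_countP_posRoots_le_two_of_left_param`) then yields, for EVERY real `λ > 1`, the disjunction
(`window_four_left_row_of_sharp`)
  `(V(U₁+V)Cc)^V ((U₁+V)Cc)^W < (λU₁B)^W ((V+W)S·E)^V`  ∨  `((λ−1)U₁B)^V ((U₁+V)Cc)^(V+W) ≤ (S·E)^V (λU₁B)^(V+W)`
  ∨  `(U₁A)^V ((U₁+V)Cc)^(U₁+V) ≤ (V·Cc)^V (λU₁B)^(U₁+V)`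
— three monomial inequalities, i.e. after `Real.log` three LOG-LINEAR rows in `log|c_t| + log M_t`; the first two bound the same linear form
from below, so an LP certificate branches TWO ways («row A ∨ row B»).  This is the kernel form of the W4 point cut of the engine-2 g30 located
instrument hybrid32 (channel column of chamber 1706).  Nothing here bounds any census count; `DoorA26` OPEN; nothing on `MatrixDescartes`
(stmt-ValiantsHypothesis-18050) or `VP ≠ VNP`.

[folklore] Rolle with multiplicity (Euler twists) + the window-4 witness; no single source.
-/

-- `Summit.ValiantsHypothesis.ValiantsHypothesis.…` repeats a component by the D-0017 layout
-- (single-conjunct summit), which the `dupNamespace` linter flags; the name is mandated.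
set_option linter.dupNamespace false

namespace Summit.ValiantsHypothesis.ValiantsHypothesis.Theorems.LacunarySymmetroidMatrixDescartes.Census

open Polynomial Finset
open scoped BigOperators Polynomial

/-- Positive roots with multiplicity are unchanged by a nonzero constant factor and a power of `X`. [folklore] -/
theorem countP_posRoots_C_mul_X_pow_mul {σ : ℝ} (hσ : σ ≠ 0) (k : ℕ) {g : ℝ[X]} (hg : g ≠ 0) :
    (C σ * X ^ k * g).roots.countP (fun x => 0 < x) = g.roots.countP (fun x => 0 < x) := by
  have h1 : C σ * X ^ k ≠ 0 := mul_ne_zero (by rwa [Ne, C_eq_zero]) (pow_ne_zero _ X_ne_zero)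
  rw [roots_mul (mul_ne_zero h1 hg), Multiset.countP_add, roots_C_mul _ hσ, roots_X_pow]
  have : (k • ({0} : Multiset ℝ)).countP (fun x => 0 < x) = 0 := by
    rw [Multiset.countP_eq_zero]
    intro x hx
    rw [Multiset.mem_nsmul] at hx
    rcases hx with ⟨-, hx⟩
    rw [Multiset.mem_singleton] at hx
    rw [hx]; exact lt_irrefl 0
  rw [this, zero_add]

/-- **The twisted WINDOW of a sharp fewnomial keeps three positive roots (with multiplicity) and alternates.**  For `r < s < u < v < n`,
with `P_t = ∏_{w<n, w∉{r,s,u,v}} (e_t − e_w)`: the residual 4-nomial has `#Z₊^mult ≥ 3`, and consecutive residual coefficients have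
opposite signs. [folklore] -/
theorem window_four_countP_of_sharp {n : ℕ} {e : ℕ → ℕ} {c : ℕ → ℝ} (he : ∀ i j, i < j → j < n → e i < e j)
    (hZ : n ≤ (∑ t ∈ range n, C (c t) * X ^ (e t) : ℝ[X]).roots.countP (fun x => 0 < x) + 1)
    {r s u v : ℕ} (hrs : r < s) (hsu : s < u) (huv : u < v) (hvn : v < n) :
    3 ≤ ((C (c r * ∏ w ∈ (range n).filter (fun w => ¬(w = r ∨ w = s ∨ w = u ∨ w = v)), ((e r : ℝ) - e w)) * X ^ (e r)
        + C (c s * ∏ w ∈ (range n).filter (fun w => ¬(w = r ∨ w = s ∨ w = u ∨ w = v)), ((e s : ℝ) - e w)) * X ^ (e s)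
        + C (c u * ∏ w ∈ (range n).filter (fun w => ¬(w = r ∨ w = s ∨ w = u ∨ w = v)), ((e u : ℝ) - e w)) * X ^ (e u)
        + C (c v * ∏ w ∈ (range n).filter (fun w => ¬(w = r ∨ w = s ∨ w = u ∨ w = v)), ((e v : ℝ) - e w)) * X ^ (e v)
          : ℝ[X]).roots.countP (fun x => 0 < x))
    ∧ (c r * ∏ w ∈ (range n).filter (fun w => ¬(w = r ∨ w = s ∨ w = u ∨ w = v)), ((e r : ℝ) - e w))
        * (c s * ∏ w ∈ (range n).filter (fun w => ¬(w = r ∨ w = s ∨ w = u ∨ w = v)), ((e s : ℝ) - e w)) < 0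
    ∧ (c s * ∏ w ∈ (range n).filter (fun w => ¬(w = r ∨ w = s ∨ w = u ∨ w = v)), ((e s : ℝ) - e w))
        * (c u * ∏ w ∈ (range n).filter (fun w => ¬(w = r ∨ w = s ∨ w = u ∨ w = v)), ((e u : ℝ) - e w)) < 0
    ∧ (c u * ∏ w ∈ (range n).filter (fun w => ¬(w = r ∨ w = s ∨ w = u ∨ w = v)), ((e u : ℝ) - e w))
        * (c v * ∏ w ∈ (range n).filter (fun w => ¬(w = r ∨ w = s ∨ w = u ∨ w = v)), ((e v : ℝ) - e w)) < 0 := by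
  classical
  set U : Finset ℕ := (range n).filter (fun w => ¬(w = r ∨ w = s ∨ w = u ∨ w = v)) with hU_def
  have hK : (range n).filter (fun w => w = r ∨ w = s ∨ w = u ∨ w = v) = insert r (insert s (insert u {v})) := by
    ext w
    simp only [mem_filter, mem_range, mem_insert, mem_singleton]
    constructor
    · rintro ⟨-, h⟩; exact h
    · intro h; refine ⟨?_, h⟩; rcases h with h | h | h | h <;> omega
  have h4 : (insert r (insert s (insert u ({v} : Finset ℕ)))).card = 4 := by
    rw [card_insert_of_notMem, card_insert_of_notMem, card_insert_of_notMem, card_singleton]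
    · simp only [mem_singleton]; omega
    · simp only [mem_insert, mem_singleton]; omega
    · simp only [mem_insert, mem_singleton]; omega
  have hUcard : U.card = n - 4 := by
    have h := Finset.card_filter_add_card_filter_not (s := range n) (fun w => w = r ∨ w = s ∨ w = u ∨ w = v)
    rw [hK, card_range, h4] at h
    rw [hU_def]; omega
  have step := countP_posRoots_le_countP_twists n e c U
  rw [hUcard] at step
  set P : ℕ → ℝ := fun t => ∏ w ∈ U, ((e t : ℝ) - e w) with hP_def
  have hres : (∑ t ∈ range n, C (c t * ∏ w ∈ U, ((e t : ℝ) - e w)) * X ^ (e t) : ℝ[X])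
      = C (c r * P r) * X ^ (e r) + C (c s * P s) * X ^ (e s) + C (c u * P u) * X ^ (e u) + C (c v * P v) * X ^ (e v) := by
    rw [← Finset.sum_filter_add_sum_filter_not (range n) (fun w => w = r ∨ w = s ∨ w = u ∨ w = v), hK]
    have hz : (∑ t ∈ U, C (c t * ∏ w ∈ U, ((e t : ℝ) - e w)) * X ^ (e t) : ℝ[X]) = 0 := by
      refine Finset.sum_eq_zero fun t ht => ?_
      rw [Finset.prod_eq_zero ht (sub_self _), mul_zero, map_zero, zero_mul]
    rw [← hU_def, hz, add_zero, sum_insert, sum_insert, sum_insert, sum_singleton]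
    · simp only [hP_def]; ring
    · simp only [mem_singleton]; omega
    · simp only [mem_insert, mem_singleton]; omega
    · simp only [mem_insert, mem_singleton]; omega
  rw [hres] at step
  have hroot3 : 3 ≤ ((C (c r * P r) * X ^ (e r) + C (c s * P s) * X ^ (e s) + C (c u * P u) * X ^ (e u)
      + C (c v * P v) * X ^ (e v) : ℝ[X]).roots.countP (fun x => 0 < x)) := by omega
  refine ⟨hroot3, ?_⟩
  -- alternation of the residual 4-nomial via `sign_of_sharp` on `range 4`
  set e' : ℕ → ℕ := fun t => if t = 0 then e r else if t = 1 then e s else if t = 2 then e u else e v with he'_def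
  set c' : ℕ → ℝ := fun t => if t = 0 then c r * P r else if t = 1 then c s * P s else if t = 2 then c u * P u else c v * P v
    with hc'_def
  have hres4 : (∑ t ∈ range 4, C (c' t) * X ^ (e' t) : ℝ[X])
      = C (c r * P r) * X ^ (e r) + C (c s * P s) * X ^ (e s) + C (c u * P u) * X ^ (e u) + C (c v * P v) * X ^ (e v) := by
    simp only [Finset.sum_range_succ, Finset.sum_range_zero, zero_add, he'_def, hc'_def]
    norm_num
  have hers : e r < e s := he r s hrs (by omega)
  have hesu : e s < e u := he s u hsu (by omega)
  have heuv : e u < e v := he u v huv hvn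
  have he' : ∀ i j, i < j → j < 4 → e' i < e' j := by
    intro i j hij hj
    interval_cases j <;> interval_cases i <;> simp [he'_def] <;> omega
  have hZ4 : 4 ≤ (∑ t ∈ range 4, C (c' t) * X ^ (e' t) : ℝ[X]).roots.countP (fun x => 0 < x) + 1 := by
    rw [hres4]; omega
  have h01 := sign_of_sharp he' (by norm_num) hZ4 (show 0 < 4 by norm_num) (show 1 < 4 by norm_num)
  have h12 := sign_of_sharp he' (by norm_num) hZ4 (show 1 < 4 by norm_num) (show 2 < 4 by norm_num)
  have h23 := sign_of_sharp he' (by norm_num) hZ4 (show 2 < 4 by norm_num) (show 3 < 4 by norm_num)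
  simp only [hc'_def] at h01 h12 h23
  norm_num at h01 h12 h23
  exact ⟨by linarith, by linarith, by linarith⟩

/-- **Core of the window-4 left row** (pure form): an alternating 4-nomial `κr X^er + κs X^es + κu X^eu + κv X^ev`
(consecutive coefficients of opposite signs, gaps `U₁, V, W ≥ 1`) with at least three positive roots counted with multiplicity satisfies,
for every real `λ > 1`, one of the three negated left-witness monomial inequalities in `|κr|, |κs|, |κu|, |κv|`. [folklore] -/
theorem window_four_left_row_core {κr κs κu κv : ℝ} {er es eu ev U₁ V W : ℕ}
    (hU₁ : er + U₁ = es) (hV : es + V = eu) (hW : eu + W = ev) (hU₁0 : 0 < U₁) (hV0 : 0 < V) (hW0 : 0 < W)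
    (h3 : 3 ≤ ((C κr * X ^ er + C κs * X ^ es + C κu * X ^ eu + C κv * X ^ ev : ℝ[X]).roots.countP (fun x => 0 < x)))
    (hsg1 : κr * κs < 0) (hsg2 : κs * κu < 0) (hsg3 : κu * κv < 0) (lam : ℝ) (hlam : 1 < lam) :
    ((V : ℝ) * ((U₁ : ℝ) + V) * |κu|) ^ V * (((U₁ : ℝ) + V) * |κu|) ^ W
        < (lam * ((U₁ : ℝ) * |κs|)) ^ W * (((V : ℝ) + W) * ((U₁ : ℝ) + V + W) * |κv|) ^ V
    ∨ ((lam - 1) * ((U₁ : ℝ) * |κs|)) ^ V * (((U₁ : ℝ) + V) * |κu|) ^ (V + W)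
        ≤ (((U₁ : ℝ) + V + W) * |κv|) ^ V * (lam * ((U₁ : ℝ) * |κs|)) ^ (V + W)
    ∨ ((U₁ : ℝ) * |κr|) ^ V * (((U₁ : ℝ) + V) * |κu|) ^ (U₁ + V)
        ≤ ((V : ℝ) * |κu|) ^ V * (lam * ((U₁ : ℝ) * |κs|)) ^ (U₁ + V) := by
  have hκr0 : κr ≠ 0 := by intro h; rw [h, zero_mul] at hsg1; exact lt_irrefl 0 hsg1
  have hκs0 : κs ≠ 0 := by intro h; rw [h, mul_zero] at hsg1; exact lt_irrefl 0 hsg1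
  have hκu0 : κu ≠ 0 := by intro h; rw [h, mul_zero] at hsg2; exact lt_irrefl 0 hsg2
  have hκv0 : κv ≠ 0 := by intro h; rw [h, mul_zero] at hsg3; exact lt_irrefl 0 hsg3
  have hAp : 0 < |κr| := abs_pos.mpr hκr0
  have hBp : 0 < |κs| := abs_pos.mpr hκs0
  have hCp : 0 < |κu| := abs_pos.mpr hκu0
  have hEp : 0 < |κv| := abs_pos.mpr hκv0
  -- normal form: residual = C σ · X^er · g with g = |κr| − |κs| X^U₁ + |κu| X^(U₁+V) − |κv| X^(U₁+V+W), σ = sign κr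
  obtain ⟨σ, hσ0, hσr, hσs, hσu, hσv⟩ : ∃ σ : ℝ, σ ≠ 0 ∧ κr = σ * |κr| ∧ κs = -(σ * |κs|) ∧ κu = σ * |κu| ∧ κv = -(σ * |κv|) := by
    rcases lt_or_gt_of_ne hκr0 with hr | hr
    · have hs : 0 < κs := by nlinarith
      have hu : κu < 0 := by nlinarith
      have hv : 0 < κv := by nlinarith
      refine ⟨-1, by norm_num, ?_, ?_, ?_, ?_⟩
      · rw [abs_of_neg hr]; ring
      · rw [abs_of_pos hs]; ring
      · rw [abs_of_neg hu]; ring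
      · rw [abs_of_pos hv]; ring
    · have hs : κs < 0 := by nlinarith
      have hu : 0 < κu := by nlinarith
      have hv : κv < 0 := by nlinarith
      refine ⟨1, by norm_num, ?_, ?_, ?_, ?_⟩
      · rw [abs_of_pos hr]; ring
      · rw [abs_of_neg hs]; ring
      · rw [abs_of_pos hu]; ring
      · rw [abs_of_neg hv]; ring
  set g : ℝ[X] := C |κr| - C |κs| * X ^ U₁ + C |κu| * X ^ (U₁ + V) - C |κv| * X ^ (U₁ + V + W) with hgdef
  have hes : es = er + U₁ := hU₁.symm
  have heu : eu = er + (U₁ + V) := by omega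
  have hev : ev = er + (U₁ + V + W) := by omega
  have hfac' : (C (σ * |κr|) * X ^ er + C (-(σ * |κs|)) * X ^ es + C (σ * |κu|) * X ^ eu + C (-(σ * |κv|)) * X ^ ev : ℝ[X])
      = C σ * X ^ er * g := by
    rw [hgdef, hes, heu, hev]
    simp only [map_neg, map_mul, pow_add]
    ring
  have hfac : (C κr * X ^ er + C κs * X ^ es + C κu * X ^ eu + C κv * X ^ ev : ℝ[X]) = C σ * X ^ er * g := by
    rw [← hfac', ← hσr, ← hσs, ← hσu, ← hσv]
  have hg0 : g ≠ 0 := by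
    intro h0
    have := congrArg (fun q : ℝ[X] => q.coeff 0) h0
    simp only [hgdef, coeff_sub, coeff_add, coeff_C_zero, coeff_C_mul, coeff_X_pow, coeff_zero] at this
    have h1 : (0 : ℕ) ≠ U₁ := by omega
    have h2 : (0 : ℕ) ≠ U₁ + V := by omega
    have h3' : (0 : ℕ) ≠ U₁ + V + W := by omega
    simp only [h1, h2, h3', if_false, mul_zero, sub_zero, add_zero] at this
    exact hAp.ne' this
  have h3g : 3 ≤ g.roots.countP (fun x => 0 < x) := by
    rw [← countP_posRoots_C_mul_X_pow_mul hσ0 er hg0, ← hfac]; exact h3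
  -- contrapositive of the left parametric witness row with multiplicity
  by_contra hnot
  push Not at hnot
  obtain ⟨hD1, hD2, hD3⟩ := hnot
  have hden : 0 < ((U₁ : ℝ) + V) * |κu| := by positivity
  obtain ⟨ρ, hρdef'⟩ : ∃ ρ : ℝ, ρ = lam * ((U₁ : ℝ) * |κs|) / (((U₁ : ℝ) + V) * |κu|) := ⟨_, rfl⟩
  have hlam0 : 0 < lam := by linarith
  have hρ : 0 < ρ := by rw [hρdef']; positivity
  have hρdef : ρ * (((U₁ : ℝ) + V) * |κu|) = lam * ((U₁ : ℝ) * |κs|) := by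
    rw [hρdef']; field_simp
  have hρW : ρ ^ W * (((U₁ : ℝ) + V) * |κu|) ^ W = (lam * ((U₁ : ℝ) * |κs|)) ^ W := by rw [← mul_pow, hρdef]
  have hρVW : ρ ^ (V + W) * (((U₁ : ℝ) + V) * |κu|) ^ (V + W) = (lam * ((U₁ : ℝ) * |κs|)) ^ (V + W) := by
    rw [← mul_pow, hρdef]
  have hρUV : ρ ^ (U₁ + V) * (((U₁ : ℝ) + V) * |κu|) ^ (U₁ + V) = (lam * ((U₁ : ℝ) * |κs|)) ^ (U₁ + V) := by
    rw [← mul_pow, hρdef]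
  have hdW : 0 < (((U₁ : ℝ) + V) * |κu|) ^ W := pow_pos hden W
  have hdVW : 0 < (((U₁ : ℝ) + V) * |κu|) ^ (V + W) := pow_pos hden (V + W)
  have hdUV : 0 < (((U₁ : ℝ) + V) * |κu|) ^ (U₁ + V) := pow_pos hden (U₁ + V)
  have h1 : ρ ^ W * ((((V : ℝ) + W) * ((U₁ : ℝ) + V + W) * |κv|)) ^ V ≤ ((V : ℝ) * ((U₁ : ℝ) + V) * |κu|) ^ V := by
    have key : (ρ ^ W * ((((V : ℝ) + W) * ((U₁ : ℝ) + V + W) * |κv|)) ^ V) * (((U₁ : ℝ) + V) * |κu|) ^ W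
        ≤ ((V : ℝ) * ((U₁ : ℝ) + V) * |κu|) ^ V * (((U₁ : ℝ) + V) * |κu|) ^ W := by
      have heq : (ρ ^ W * ((((V : ℝ) + W) * ((U₁ : ℝ) + V + W) * |κv|)) ^ V) * (((U₁ : ℝ) + V) * |κu|) ^ W
          = (lam * ((U₁ : ℝ) * |κs|)) ^ W * (((V : ℝ) + W) * ((U₁ : ℝ) + V + W) * |κv|) ^ V := by
        rw [← hρW]; ring
      rw [heq]; exact hD1
    exact le_of_mul_le_mul_right key hdW
  have h2 : (((U₁ : ℝ) + V + W) * |κv|) ^ V * ρ ^ (V + W) < ((lam - 1) * ((U₁ : ℝ) * |κs|)) ^ V := by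
    have key : ((((U₁ : ℝ) + V + W) * |κv|) ^ V * ρ ^ (V + W)) * (((U₁ : ℝ) + V) * |κu|) ^ (V + W)
        < ((lam - 1) * ((U₁ : ℝ) * |κs|)) ^ V * (((U₁ : ℝ) + V) * |κu|) ^ (V + W) := by
      have heq : ((((U₁ : ℝ) + V + W) * |κv|) ^ V * ρ ^ (V + W)) * (((U₁ : ℝ) + V) * |κu|) ^ (V + W)
          = (((U₁ : ℝ) + V + W) * |κv|) ^ V * (lam * ((U₁ : ℝ) * |κs|)) ^ (V + W) := by rw [← hρVW]; ring
      rw [heq]; exact hD2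
    exact lt_of_mul_lt_mul_right key hdVW.le
  have h2' : 0 ≤ (lam - 1) * ((U₁ : ℝ) * |κs|) := by
    have : 0 ≤ lam - 1 := by linarith
    positivity
  have h3' : ((V : ℝ) * |κu|) ^ V * ρ ^ (U₁ + V) < ((U₁ : ℝ) * |κr|) ^ V := by
    have key : (((V : ℝ) * |κu|) ^ V * ρ ^ (U₁ + V)) * (((U₁ : ℝ) + V) * |κu|) ^ (U₁ + V)
        < ((U₁ : ℝ) * |κr|) ^ V * (((U₁ : ℝ) + V) * |κu|) ^ (U₁ + V) := by
      have heq : (((V : ℝ) * |κu|) ^ V * ρ ^ (U₁ + V)) * (((U₁ : ℝ) + V) * |κu|) ^ (U₁ + V)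
          = ((V : ℝ) * |κu|) ^ V * (lam * ((U₁ : ℝ) * |κs|)) ^ (U₁ + V) := by rw [← hρUV]; ring
      rw [heq]; exact hD3
    exact lt_of_mul_lt_mul_right key hdUV.le
  have hle2 := fourNomial_countP_posRoots_le_two_of_left_param hU₁0 hV0 hW0 hAp hBp hCp hEp hρ hρdef h1 h2 h2' h3'
  have hle2' : g.roots.countP (fun x => 0 < x) ≤ 2 := by rw [hgdef]; exact hle2
  omega

/-- **WINDOW-4 LEFT ROW OF A SHARP FEWNOMIAL (multiplicative form).**  Under the hypotheses of `window_four_countP_of_sharp`, with the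
gaps `U₁, V, W` and the absolute twist multipliers `M_t` supplied as hypotheses, and `A = |c_r|·M_r`, `B = |c_s|·M_s`, `Cc = |c_u|·M_u`,
`E = |c_v|·M_v`: for every real `λ > 1` one of the three negated left-witness monomial inequalities holds. [folklore] -/
theorem window_four_left_row_of_sharp {n : ℕ} {e : ℕ → ℕ} {c : ℕ → ℝ} (he : ∀ i j, i < j → j < n → e i < e j)
    (hZ : n ≤ (∑ t ∈ range n, C (c t) * X ^ (e t) : ℝ[X]).roots.countP (fun x => 0 < x) + 1)
    {r s u v : ℕ} (hrs : r < s) (hsu : s < u) (huv : u < v) (hvn : v < n)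
    (U₁ V W : ℕ) (hU₁ : e r + U₁ = e s) (hV : e s + V = e u) (hW : e u + W = e v)
    (Mr Ms Mu Mv : ℝ)
    (hMr : |∏ w ∈ (range n).filter (fun w => ¬(w = r ∨ w = s ∨ w = u ∨ w = v)), ((e r : ℝ) - e w)| = Mr)
    (hMs : |∏ w ∈ (range n).filter (fun w => ¬(w = r ∨ w = s ∨ w = u ∨ w = v)), ((e s : ℝ) - e w)| = Ms)
    (hMu : |∏ w ∈ (range n).filter (fun w => ¬(w = r ∨ w = s ∨ w = u ∨ w = v)), ((e u : ℝ) - e w)| = Mu)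
    (hMv : |∏ w ∈ (range n).filter (fun w => ¬(w = r ∨ w = s ∨ w = u ∨ w = v)), ((e v : ℝ) - e w)| = Mv)
    (lam : ℝ) (hlam : 1 < lam) :
    ((V : ℝ) * ((U₁ : ℝ) + V) * (|c u| * Mu)) ^ V * (((U₁ : ℝ) + V) * (|c u| * Mu)) ^ W
        < (lam * ((U₁ : ℝ) * (|c s| * Ms))) ^ W * (((V : ℝ) + W) * ((U₁ : ℝ) + V + W) * (|c v| * Mv)) ^ V
    ∨ ((lam - 1) * ((U₁ : ℝ) * (|c s| * Ms))) ^ V * (((U₁ : ℝ) + V) * (|c u| * Mu)) ^ (V + W)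
        ≤ (((U₁ : ℝ) + V + W) * (|c v| * Mv)) ^ V * (lam * ((U₁ : ℝ) * (|c s| * Ms))) ^ (V + W)
    ∨ ((U₁ : ℝ) * (|c r| * Mr)) ^ V * (((U₁ : ℝ) + V) * (|c u| * Mu)) ^ (U₁ + V)
        ≤ ((V : ℝ) * (|c u| * Mu)) ^ V * (lam * ((U₁ : ℝ) * (|c s| * Ms))) ^ (U₁ + V) := by
  have hU₁0 : 0 < U₁ := by have := he r s hrs (by omega); omega
  have hV0 : 0 < V := by have := he s u hsu (by omega); omega
  have hW0 : 0 < W := by have := he u v huv hvn; omega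
  obtain ⟨h3, hsg1, hsg2, hsg3⟩ := window_four_countP_of_sharp he hZ hrs hsu huv hvn
  rw [← hMr, ← hMs, ← hMu, ← hMv]
  simp only [← abs_mul]
  exact window_four_left_row_core hU₁ hV hW hU₁0 hV0 hW0 h3 hsg1 hsg2 hsg3 lam hlam

end Summit.ValiantsHypothesis.ValiantsHypothesis.Theorems.LacunarySymmetroidMatrixDescartes.Census
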